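/-
HONEST FRAMING: certified error envelopes and provably optimal rounding/accumulation schemes for
low-precision formats under stated cost models; every table by two implementations; no hardware
or vendor claims.
-/
import Summits.Ventures.CertifiedArithmetic.LowPrec.OptDemotionGrid
import Summits.Ventures.CertifiedArithmetic.LowPrec.OptDemotionNodeI
import Summits.Ventures.CertifiedArithmetic.LowPrec.OptDemotionNodeIII
import Summits.Ventures.CertifiedArithmetic.LowPrec.OptDemotionNodeIIIs

/-!
# The demotion law (Theorem T8), part 5e: the node step in `F(q, emin)`

From the arithmetic node lemmas (`OptDemotionNodeI/III/IIIs`, normalised hypotheses) to the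
floating-point statement: if `v = fl_q(v_a + v_b) ∈ [2^K, 2^(K+1))` for nonnegative floats
`v_a, v_b` of `F(q, emin)` whose deficits are bounded by their active lines, then the node deficit
`d_a + d_b + (v_a + v_b - v)` is covered by one of the eight candidate lines at scale `2^K`
(`node_covers`).  Ingredients: the grid facts of `OptDemotionGrid` and the case analysis "one child in
the top binade / both children below it (then the larger one sits in the binade just below)".
-/

namespace Summit.Ventures.CertifiedArithmetic.LowPrec.Opt

open Literature.ComputerArithmetic.JeannerodRump2018
open Demotion

/-! ## The node step -/

section NodeStep

variable {q : ℕ} {emin : ℤ} {fl : ℚ → ℚ}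

/-- THE NODE STEP, ordered version (`v_b ≤ v_a`).  Nonnegative floats `v_a, v_b` of `F(q, emin)`
with deficits `d_a ≤ ufp(v_a)(α_a - λ_a) + λ_a v_a` (active good line of `a`, `0 ≤ λ_a ≤ α_a ≤ μ_a ≤ 1`)
and likewise `d_b` (or `d_b ≤ 0` if `v_b = 0`); if `v = fl(v_a + v_b) ∈ [2^K, 2^(K+1))` then the node
deficit `d_a + d_b + (v_a + v_b - v)` is covered by one of the eight candidate lines at scale `2^K`. -/
theorem node_covers_ord (hq : 1 ≤ q) (hfl : IsRoundNearest q emin fl)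
    {va vb da db Ma Aa La Mb Ab Lb : ℚ}
    (ha : IsFloat q emin va) (hb : IsFloat q emin vb) (hb0 : 0 ≤ vb) (hab : vb ≤ va)
    (hLa : 0 ≤ La) (hAaLa : La ≤ Aa) (hMaAa : Aa ≤ Ma) (hMa1 : Ma ≤ 1)
    (hLb : 0 ≤ Lb) (hAbLb : Lb ≤ Ab) (hMbAb : Ab ≤ Mb) (hMb1 : Mb ≤ 1)
    (hda : 0 < va → da ≤ (2 : ℚ) ^ (Int.log 2 va) * (Aa - La) + La * va)
    (hdb0 : vb = 0 → db ≤ 0)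
    (hdb : 0 < vb → db ≤ (2 : ℚ) ^ (Int.log 2 vb) * (Ab - Lb) + Lb * vb)
    {K : ℤ} (hvlo : (2 : ℚ) ^ K ≤ fl (va + vb)) (hvhi : fl (va + vb) < (2 : ℚ) ^ (K + 1)) :
    Covers (unitRoundoff q) ((2 : ℚ) ^ K) (fl (va + vb)) Ma Aa La Mb Ab Lb
      (da + db + (va + vb - fl (va + vb))) := by
  have h2 : (2 : ℚ) ≠ 0 := by norm_num
  have hσpos : (0 : ℚ) < (2 : ℚ) ^ K := zpow_pos (by norm_num) _
  have hu0 : 0 ≤ unitRoundoff q := unitRoundoff_nonneg q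
  have hupos : 0 < unitRoundoff q := by unfold unitRoundoff; positivity
  have hu2 : unitRoundoff q ≤ 1 / 2 := by
    unfold unitRoundoff
    have h2q : (2 : ℚ) ≤ 2 ^ q := by
      calc (2 : ℚ) = 2 ^ 1 := by norm_num
        _ ≤ 2 ^ q := pow_le_pow_right₀ (by norm_num) hq
    rw [div_le_div_iff₀ (by positivity) (by norm_num)]; linarith
  obtain ⟨hug, hug2⟩ := u_mul_zpow q K
  have huσ : 0 < unitRoundoff q * (2 : ℚ) ^ K := mul_pos hupos hσpos
  have hvF : IsFloat q emin (fl (va + vb)) := (hfl _).1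
  have hva0 : 0 ≤ va := hb0.trans hab
  have hvpos : 0 < fl (va + vb) := lt_of_lt_of_le hσpos hvlo
  have hvav : va ≤ fl (va + vb) := le_fl_of_isFloat_le hfl ha (by linarith)
  have hvbv : vb ≤ fl (va + vb) := le_fl_of_isFloat_le hfl hb (by linarith)
  obtain ⟨habs, hhalf⟩ := round_sum_facts hq hfl ha hb hva0 hb0 hvhi
  have hsumhi : va + vb ≤ fl (va + vb) + unitRoundoff q * (2 : ℚ) ^ K := by
    have := (abs_le.mp habs).2; linarith
  have hsumlo : fl (va + vb) - unitRoundoff q * (2 : ℚ) ^ K ≤ va + vb := by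
    have := (abs_le.mp habs).1; linarith
  have hxtop : fl (va + vb) ≤ 2 * (2 : ℚ) ^ K - 2 * unitRoundoff q * (2 : ℚ) ^ K := by
    have h1 := isFloat_le_top hvF hvpos hvhi
    rw [zpow_add_one₀ h2] at h1; rw [hug2]; linarith
  have hvapos : 0 < va := by
    by_contra h0
    have hva : va = 0 := le_antisymm (not_lt.mp h0) hva0
    have hvb : vb = 0 := le_antisymm (hva ▸ hab) hb0
    have : fl (va + vb) = 0 := by
      rw [hva, hvb, add_zero]; exact fl_eq_self hfl (isFloat_zero q emin)
    linarith
  rcases eq_or_lt_of_le hb0 with hvb0 | hvbpos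
  · -- v_b = 0: the node just copies v_a
    have hvb0' : vb = 0 := hvb0.symm
    have hvva : fl (va + vb) = va := by rw [hvb0', add_zero]; exact fl_eq_self hfl ha
    have hloga : Int.log 2 va = K :=
      int_log_eq_of_mem hvapos (by rw [← hvva]; exact hvlo) (by rw [← hvva]; exact hvhi)
    have hda' := hda hvapos
    rw [hloga] at hda'
    have hdb' := hdb0 hvb0'
    have hT : da + db + (va + vb - fl (va + vb)) ≤ (Aa - La) * (2 : ℚ) ^ K + La * fl (va + vb) := by
      rw [hvva, hvb0']; linarith
    rcases le_total Mb Ma with hM | hM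
    · exact (node_I0_a _ _ _ Aa La Ma Ab Lb Mb hu0 hu2 hσpos.le hvlo hxtop hLa hAaLa hMaAa hMa1
        hLb hAbLb hMbAb hMb1 hM).mono hT
    · exact (node_I0_b _ _ _ Aa La Ma Ab Lb Mb hu0 hu2 hσpos.le hvlo hxtop hLa hAaLa hMaAa hMa1
        hLb hAbLb hMbAb hMb1 hM).mono hT
  · -- v_b > 0: its binade [πb, 2πb)
    set kb := Int.log 2 vb with hkb
    have hπlo : ((2 : ℕ) : ℚ) ^ kb ≤ vb := Int.zpow_log_le_self (by norm_num) hvbpos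
    have hπhi : vb < ((2 : ℕ) : ℚ) ^ (kb + 1) := Int.lt_zpow_succ_log_self (by norm_num) vb
    push_cast at hπlo hπhi
    have hπpos : (0 : ℚ) < (2 : ℚ) ^ kb := zpow_pos (by norm_num) _
    have hdb' := hdb hvbpos
    obtain ⟨hugb, hug2b⟩ := u_mul_zpow q kb
    have hvbtop : vb ≤ 2 * (2 : ℚ) ^ kb - 2 * unitRoundoff q * (2 : ℚ) ^ kb := by
      have h1 := isFloat_le_top hb hvbpos hπhi
      rw [zpow_add_one₀ h2] at h1; rw [hug2b]; linarith
    rcases le_or_gt ((2 : ℚ) ^ K) va with hI | hIII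
    · -- CASE I: `a` sits in the top binade
      have hloga : Int.log 2 va = K := int_log_eq_of_mem hvapos hI (lt_of_le_of_lt hvav hvhi)
      have hda' := hda hvapos
      rw [hloga] at hda'
      have hvbσ : vb < (2 : ℚ) ^ K := by linarith
      have hkbK : kb + 1 ≤ K := by
        have := (Int.lt_zpow_iff_log_lt (b := 2) (by norm_num) hvbpos).mp (by exact_mod_cast hvbσ)
        omega
      have hπhalf : (2 : ℚ) ^ kb ≤ (2 : ℚ) ^ K / 2 := by
        have := zpow_le_zpow_right₀ (a := (2 : ℚ)) (by norm_num) hkbK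
        rw [zpow_add_one₀ h2] at this; linarith
      obtain ⟨N, hN⟩ := isFloat_grid hvF hvlo
      obtain ⟨Na, hNa⟩ := isFloat_grid ha hI
      have hgpos : (0 : ℚ) < (2 : ℚ) ^ (K + 1 - q) := zpow_pos (by norm_num) _
      have hT : da + db + (va + vb - fl (va + vb)) ≤ (Aa - La) * (2 : ℚ) ^ K + La * va
          + (Ab - Lb) * (2 : ℚ) ^ kb + Lb * vb + (va + vb - fl (va + vb)) := by linarith
      rcases le_or_gt (K + 1 - q) kb with hA | hB
      · -- IA: πb ≥ 2uσ, so πb and va live on the grid 2uσ of the top binade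
        have hpb2u : 2 * unitRoundoff q * (2 : ℚ) ^ K ≤ (2 : ℚ) ^ kb := by
          rw [hug2]; exact zpow_le_zpow_right₀ (by norm_num) hA
        obtain ⟨d, hd⟩ : ∃ d : ℕ, kb = (K + 1 - q) + d := ⟨(kb - (K + 1 - q)).toNat, by omega⟩
        have hπg : (2 : ℚ) ^ kb = ((2 ^ d : ℤ) : ℚ) * (2 : ℚ) ^ (K + 1 - q) := by
          rw [hd, zpow_add₀ h2, zpow_natCast]; push_cast; ring
        obtain ⟨e, he⟩ : ∃ e : ℕ, (q : ℤ) = 1 + e := ⟨q - 1, by omega⟩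
        have hσg : (2 : ℚ) ^ K = ((2 ^ e : ℤ) : ℚ) * (2 : ℚ) ^ (K + 1 - q) := by
          push_cast
          rw [← zpow_natCast, ← zpow_add₀ h2]; congr 1; omega
        have hxpb : (2 : ℚ) ^ kb ≤ fl (va + vb) - (2 : ℚ) ^ K := by
          refine grid_le_of_lt hgpos hπg (b := fl (va + vb) - (2 : ℚ) ^ K) (B := N - 2 ^ e)
            (by rw [hN, hσg]; push_cast; ring) ?_
          linarith
        have hgran : (2 : ℚ) ^ kb + va ≤ fl (va + vb) := by
          refine grid_le_of_lt hgpos (A := 2 ^ d + Na) (by rw [hπg, hNa]; push_cast; ring) hN ?_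
          linarith
        rcases le_total Mb Ma with hM | hM
        · exact (node_IA_a _ _ _ va vb _ Aa La Ma Ab Lb Mb hu0 hu2 hσpos.le hvlo hxtop hLa hAaLa
            hMaAa hMa1 hLb hAbLb hMbAb hMb1 hsumhi hsumlo hvav hvbv hI hπlo hvbtop hpb2u hxpb hgran
            hπhalf hM).mono hT
        · exact (node_IA_b _ _ _ va vb _ Aa La Ma Ab Lb Mb hu0 hu2 hσpos.le hvlo hxtop hLa hAaLa
            hMaAa hMa1 hLb hAbLb hMbAb hMb1 hsumhi hsumlo hvav hvbv hI hπlo hvbtop hpb2u hxpb hgran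
            hπhalf hM).mono hT
      · -- IB: πb ≤ uσ (b is tiny)
        have hupb : (2 : ℚ) ^ kb ≤ unitRoundoff q * (2 : ℚ) ^ K := by
          rw [hug]; exact zpow_le_zpow_right₀ (by norm_num) (by omega)
        rcases eq_or_lt_of_le hvav with hEq | hLt
        · -- IB1: v_a = v
          have hvbu : vb ≤ unitRoundoff q * (2 : ℚ) ^ K := by linarith
          have hT1 : da + db + (va + vb - fl (va + vb)) ≤ (Aa - La) * (2 : ℚ) ^ K
              + La * fl (va + vb) + (Ab - Lb) * (2 : ℚ) ^ kb + Lb * vb + vb := by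
            rw [← hEq]; linarith
          rcases le_total Mb Ma with hM | hM
          · exact (node_IB1_a _ _ _ vb _ Aa La Ma Ab Lb Mb hu0 hu2 hσpos.le hvlo hxtop hLa hAaLa
              hMaAa hMa1 hLb hAbLb hMbAb hMb1 hvbu hπlo hπpos.le hupb hb0 hM).mono hT1
          · exact (node_IB1_b _ _ _ vb _ Aa La Ma Ab Lb Mb hu0 hu2 hσpos.le hvlo hxtop hLa hAaLa
              hMaAa hMa1 hLb hAbLb hMbAb hMb1 hvbu hπlo hπpos.le hupb hb0 hM).mono hT1
        · -- IB2: v_a ≤ v - 2uσ, so v_b ∈ [uσ, 2uσ): πb = uσ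
          have hva2 : va ≤ fl (va + vb) - (2 : ℚ) ^ (K + 1 - q) := by
            refine grid_le_of_lt hgpos hNa (B := N - 1) (by rw [hN]; push_cast; ring) ?_
            linarith
          rw [← hug2] at hva2
          have hvbu : unitRoundoff q * (2 : ℚ) ^ K ≤ vb := by linarith
          have hkb' : K - q ≤ kb := by
            by_contra hc
            have h1 : (2 : ℚ) ^ (kb + 1) ≤ (2 : ℚ) ^ (K - q) :=
              zpow_le_zpow_right₀ (by norm_num) (by omega)
            rw [← hug] at h1; linarith
          have hkbeq : kb = K - q := by omega
          have hπu : (2 : ℚ) ^ kb = unitRoundoff q * (2 : ℚ) ^ K := by rw [hkbeq, hug]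
          rw [hπu] at hT hvbtop
          have hvbtop' : vb ≤ 2 * unitRoundoff q * (2 : ℚ) ^ K
              - 2 * unitRoundoff q * unitRoundoff q * (2 : ℚ) ^ K := by linarith
          rcases le_total Mb Ma with hM | hM
          · exact (node_IB2_a _ _ _ va vb Aa La Ma Ab Lb Mb hu0 hu2 hσpos.le hvlo hxtop hLa hAaLa
              hMaAa hMa1 hLb hAbLb hMbAb hMb1 hsumhi hsumlo hvav hvbv hI hva2 hvbu hvbtop' hM).mono hT
          · exact (node_IB2_b _ _ _ va vb Aa La Ma Ab Lb Mb hu0 hu2 hσpos.le hvlo hxtop hLa hAaLa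
              hMaAa hMa1 hLb hAbLb hMbAb hMb1 hsumhi hsumlo hvav hvbv hI hva2 hvbu hvbtop' hM).mono hT
    · -- CASE III: both children below the top binade; then `a` sits in the binade just below
      have hvatop : va ≤ (2 : ℚ) ^ K - unitRoundoff q * (2 : ℚ) ^ K := by
        have h1 := isFloat_le_top ha hvapos hIII; rw [hug]; exact h1
      have hσhalf : (2 : ℚ) ^ (K - 1) = (2 : ℚ) ^ K / 2 := by
        rw [zpow_sub_one₀ h2]; ring
      have hvah : (2 : ℚ) ^ K / 2 ≤ va := by
        by_contra hlt
        push Not at hlt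
        have hva' : va < (2 : ℚ) ^ (K - 1) := by rw [hσhalf]; exact hlt
        have h1 := isFloat_le_top ha hvapos hva'
        have h2' := isFloat_le_top hb hvbpos (lt_of_le_of_lt hab hva')
        have hq2 : (2 : ℚ) ^ (K - 1 - q) = unitRoundoff q * (2 : ℚ) ^ K / 2 := by
          rw [show K - 1 - (q : ℤ) = (K - q) - 1 by ring, zpow_sub_one₀ h2, ← hug]; ring
        rw [hσhalf, hq2] at h1 h2'
        have hsmall : va + vb < (2 : ℚ) ^ K := by linarith
        have h3 := hhalf hsmall
        linarith
      have hloga : Int.log 2 va = K - 1 :=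
        int_log_eq_of_mem hvapos (by rw [hσhalf]; exact hvah) (by rw [sub_add_cancel]; exact hIII)
      have hda' := hda hvapos
      rw [hloga, hσhalf] at hda'
      have hkbK : kb ≤ K - 1 := by
        have := (Int.lt_zpow_iff_log_lt (b := 2) (by norm_num) hvbpos).mp
          (by exact_mod_cast (lt_of_le_of_lt hab hIII))
        omega
      rcases eq_or_lt_of_le hkbK with hkA | hkB
      · -- IIIA: both children in [σ/2, σ)
        have hπb : (2 : ℚ) ^ kb = (2 : ℚ) ^ K / 2 := by rw [hkA, hσhalf]
        rw [hπb] at hπlo hdb'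
        have hvbtop' : vb ≤ (2 : ℚ) ^ K - unitRoundoff q * (2 : ℚ) ^ K := by
          have h1 := isFloat_le_top hb hvbpos (lt_of_le_of_lt hab hIII); rw [hug]; exact h1
        have hT : da + db + (va + vb - fl (va + vb)) ≤ (Aa - La) * ((2 : ℚ) ^ K / 2) + La * va
            + (Ab - Lb) * ((2 : ℚ) ^ K / 2) + Lb * vb + (va + vb - fl (va + vb)) := by linarith
        rcases le_total Ma Mb with hM | hM
        · exact (node_IIIA_b _ _ _ va vb Aa La Ma Ab Lb Mb hu0 hu2 hσpos.le hvlo hxtop hLa hAaLa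
            hMaAa hMa1 hLb hAbLb hMbAb hMb1 hsumhi hsumlo hvav hvbv hvah hπlo hvatop hvbtop' hM).mono hT
        · -- the mirror image: swap the roles of the two children
          have hsumhi' : vb + va ≤ fl (va + vb) + unitRoundoff q * (2 : ℚ) ^ K := by linarith
          have hsumlo' : fl (va + vb) - unitRoundoff q * (2 : ℚ) ^ K ≤ vb + va := by linarith
          have h := node_IIIA_b _ _ _ vb va Ab Lb Mb Aa La Ma hu0 hu2 hσpos.le hvlo hxtop hLb hAbLb
            hMbAb hMb1 hLa hAaLa hMaAa hMa1 hsumhi' hsumlo' hvbv hvav hπlo hvah hvbtop' hvatop hM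
          exact (Covers.swap h).mono (by linarith)
      · -- πb ≤ σ/4
        have hqpb : (2 : ℚ) ^ kb ≤ (2 : ℚ) ^ K / 4 := by
          have h1 : (2 : ℚ) ^ kb ≤ (2 : ℚ) ^ (K - 2) := zpow_le_zpow_right₀ (by norm_num) (by omega)
          rw [show K - 2 = K - 1 - 1 by ring, zpow_sub_one₀ h2, zpow_sub_one₀ h2] at h1
          linarith
        have hT : da + db + (va + vb - fl (va + vb)) ≤ (Aa - La) * ((2 : ℚ) ^ K / 2) + La * va
            + (Ab - Lb) * (2 : ℚ) ^ kb + Lb * vb + (va + vb - fl (va + vb)) := by linarith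
        rcases le_or_gt (K + 1 - q) kb with hA | hB
        · -- IIIB
          have hpb2u : 2 * unitRoundoff q * (2 : ℚ) ^ K ≤ (2 : ℚ) ^ kb := by
            rw [hug2]; exact zpow_le_zpow_right₀ (by norm_num) hA
          rcases le_total Mb Ma with hM | hM
          · exact (node_IIIB_a _ _ _ va vb _ Aa La Ma Ab Lb Mb hu0 hu2 hσpos.le hvlo hxtop hLa hAaLa
              hMaAa hMa1 hLb hAbLb hMbAb hMb1 hsumhi hsumlo hvav hvbv hvah hvatop hπlo hqpb hpb2u
              hvbtop hM).mono hT
          · exact (node_IIIB_b _ _ _ va vb _ Aa La Ma Ab Lb Mb hu0 hu2 hσpos.le hvlo hxtop hLa hAaLa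
              hMaAa hMa1 hLb hAbLb hMbAb hMb1 hsumhi hsumlo hvav hvbv hvah hvatop hπlo hqpb hpb2u
              hvbtop hM).mono hT
        · -- IIIBs
          have hupb : (2 : ℚ) ^ kb ≤ unitRoundoff q * (2 : ℚ) ^ K := by
            rw [hug]; exact zpow_le_zpow_right₀ (by norm_num) (by omega)
          rcases le_total Mb Ma with hM | hM
          · exact (node_IIIBs_a _ _ _ va vb _ Aa La Ma Ab Lb Mb hu0 hu2 hσpos.le hvlo hxtop hLa hAaLa
              hMaAa hMa1 hLb hAbLb hMbAb hMb1 hsumhi hsumlo hvav hvbv hvah hvatop hπlo hπpos.le hupb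
              hvbtop hM).mono hT
          · exact (node_IIIBs_b _ _ _ va vb _ Aa La Ma Ab Lb Mb hu0 hu2 hσpos.le hvlo hxtop hLa hAaLa
              hMaAa hMa1 hLb hAbLb hMbAb hMb1 hsumhi hsumlo hvav hvbv hvah hvatop hπlo hπpos.le hupb
              hvbtop hM).mono hT

/-- THE NODE STEP (symmetric form): for nonnegative floats `v_a, v_b` of `F(q, emin)` with deficits
bounded by good active lines, the deficit of `fl_q(v_a + v_b) ∈ [2^K, 2^(K+1))` is covered by one of
the eight candidate lines at scale `2^K`. -/
theorem node_covers (hq : 1 ≤ q) (hfl : IsRoundNearest q emin fl)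
    {va vb da db Ma Aa La Mb Ab Lb : ℚ}
    (ha : IsFloat q emin va) (hb : IsFloat q emin vb) (ha0 : 0 ≤ va) (hb0 : 0 ≤ vb)
    (hLa : 0 ≤ La) (hAaLa : La ≤ Aa) (hMaAa : Aa ≤ Ma) (hMa1 : Ma ≤ 1)
    (hLb : 0 ≤ Lb) (hAbLb : Lb ≤ Ab) (hMbAb : Ab ≤ Mb) (hMb1 : Mb ≤ 1)
    (hda0 : va = 0 → da ≤ 0) (hda : 0 < va → da ≤ (2 : ℚ) ^ (Int.log 2 va) * (Aa - La) + La * va)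
    (hdb0 : vb = 0 → db ≤ 0) (hdb : 0 < vb → db ≤ (2 : ℚ) ^ (Int.log 2 vb) * (Ab - Lb) + Lb * vb)
    {K : ℤ} (hvlo : (2 : ℚ) ^ K ≤ fl (va + vb)) (hvhi : fl (va + vb) < (2 : ℚ) ^ (K + 1)) :
    Covers (unitRoundoff q) ((2 : ℚ) ^ K) (fl (va + vb)) Ma Aa La Mb Ab Lb
      (da + db + (va + vb - fl (va + vb))) := by
  rcases le_total vb va with h | h
  · exact node_covers_ord hq hfl ha hb hb0 h hLa hAaLa hMaAa hMa1 hLb hAbLb hMbAb hMb1 hda hdb0 hdb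
      hvlo hvhi
  · have hvlo' : (2 : ℚ) ^ K ≤ fl (vb + va) := by rw [add_comm]; exact hvlo
    have hvhi' : fl (vb + va) < (2 : ℚ) ^ (K + 1) := by rw [add_comm]; exact hvhi
    have h1 := node_covers_ord hq hfl hb ha ha0 h hLb hAbLb hMbAb hMb1 hLa hAaLa hMaAa hMa1 hdb hda0
      hda hvlo' hvhi'
    rw [add_comm vb va] at h1
    exact (Covers.swap h1).mono (by linarith)

end NodeStep

end Summit.Ventures.CertifiedArithmetic.LowPrec.Opt
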